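import Literature.Geometry.Symplectic.TaubesFamilyGaugeUniqueness
import HarnessLib

/-!
# The moduli space of Taubes's family is a single (irreducible) point

Topic `Literature/Geometry/Symplectic`.  For the canonical `Spin^c` structure `𝔰_J` of a closed
symplectic `4`-manifold `(N, s, J)` and the perturbation `P₊F_{A₀} - (r/4)s` with
`r = |c|² > 16 sup_N |b|²` (`b` Taubes's torsion), the moduli space `𝓜(𝔰_J, P₊F_{A₀} - (r/4)s)` of
gauge classes of solutions of the Seiberg–Witten equations (the tree's `ModuliSpace`) is a
singleton: it contains the class of Taubes's solution `(A₀, c·u₀)` (`TaubesCanonicalSolutionStepOne`)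
and every solution is gauge equivalent to it (`TaubesFamilyGaugeUniqueness`).  Hence
`𝓜 ≃ point`, `#𝓜 = 1`, and its point is irreducible — the set-theoretic content of Taubes's Main
Theorem "the moduli space consists of a single nondegenerate point" (Taubes 1994; Taubes 1995,
Thm. 1.3, §5 Steps 1–3: `SW(K⁻¹) = ±1`), the nondegeneracy/sign being a statement about the
linearisation (`TaubesLinearizedRigidity` gives `H¹ = 0`) and the orientation, not recorded here.

## References
* C. H. Taubes, Math. Res. Lett. 1 (1994) 809–822, Main Theorem.
* C. H. Taubes, Math. Res. Lett. 2 (1995) 221–238, Thm. 1.3, §5.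
* M. Hutchings, C. H. Taubes, IAS/Park City Math. Ser. 7 (1999), Thm. 4.1 (a).
-/

noncomputable section

open scoped Manifold ContDiff Topology ComplexConjugate Matrix
open Set Function Filter Complex Literature.Geometry.Kaehler Literature.Geometry.GaugeTheory Literature.Topology.FourManifolds
open Literature.Geometry.Lorentzian (PseudoRiemannianMetric)
open Literature.Geometry.Manifold Literature.Geometry.Manifold.DeRhamSignFour Literature.NumberTheory.Transcendental

namespace Literature.Geometry.Symplectic

open Literature.Geometry.GaugeTheory.SpincStructure

namespace AlmostComplexStructure.IsCompatibleWith

variable {N : Type} [TopologicalSpace N] [ChartedSpace (EuclideanSpace ℝ (Fin 4)) N] [IsManifold (𝓡 4) ∞ N]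
  {J : AlmostComplexStructure (𝓡 4) ∞ N} {s : MForm (𝓡 4) N ℝ 2}
  (h : J.IsCompatibleWith s) (hs : IsSmoothForm s)
  (hnd : ∀ x (v : TangentSpace (𝓡 4) x), v ≠ 0 → ∃ w : TangentSpace (𝓡 4) x, s x ![v, w] ≠ 0)

variable [T2Space N] [CompactSpace N] [(h.metric hs).HasLeviCivita]

/-- **Taubes's solution as a point of the solution space** of `(SW)` with perturbation
`P₊F_{A₀} - (r/4)s`, `r = |c|²`. [cite: Taubes1995, §5 Step 1 (5.2)] -/
def taubesSolution (hcl : IsClosedForm s) (c : ℂ) :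
    (h.canonicalSpincStructure hs hnd).Solution (h.taubesPerturbation hs hnd - h.symplecticPerturbation hs hnd (Complex.normSq c / 4)) :=
  ⟨h.canonicalConfiguration hs hnd (h.taubesConnection hs hnd) c, h.isSolution_canonicalConfiguration_taubes hs hnd hcl c⟩

omit [T2Space N] [CompactSpace N] in
/-- The configuration of Taubes's solution (definitional). [cite: Taubes1995, §5 Step 1 (5.2)] -/
@[simp] theorem taubesSolution_val (hcl : IsClosedForm s) (c : ℂ) :
    (h.taubesSolution hs hnd hcl c).1 = h.canonicalConfiguration hs hnd (h.taubesConnection hs hnd) c := rfl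

omit [T2Space N] [CompactSpace N] in
/-- The moduli space of the family is non-empty: it contains the class of Taubes's solution. [cite: Taubes1995, Thm. 1.3, §5 Step 1] -/
theorem nonempty_moduliSpace (hcl : IsClosedForm s) (c : ℂ) :
    Nonempty ((h.canonicalSpincStructure hs hnd).ModuliSpace
      (h.taubesPerturbation hs hnd - h.symplecticPerturbation hs hnd (Complex.normSq c / 4))) :=
  ⟨ModuliSpace.mk (h.taubesSolution hs hnd hcl c)⟩

/-- **Every class is the class of Taubes's solution** for `r = |c|² > 16 sup_N|b|²`. [cite: Taubes1995, Thm. 1.3, §5 Step 3] [cite: Taubes1994, Main Theorem] -/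
theorem moduliSpace_eq_mk_taubesSolution (hcl : IsClosedForm s) (c : ℂ)
    (hr : 16 * (⨆ y : N, ∑ k, Complex.normSq ((h.unitaryAdaptedFrames hs hnd).canonicalTorsion
        ((h.canonicalSpincStructure hs hnd).indexAt y) y
          ((h.canonicalSpincStructure hs hnd).frame ((h.canonicalSpincStructure hs hnd).indexAt y) k y))) < Complex.normSq c)
    (p : (h.canonicalSpincStructure hs hnd).ModuliSpace
      (h.taubesPerturbation hs hnd - h.symplecticPerturbation hs hnd (Complex.normSq c / 4))) :
    p = ModuliSpace.mk (h.taubesSolution hs hnd hcl c) := by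
  induction p using Quot.ind with
  | _ q =>
    have hg : GaugeRel (h.taubesSolution hs hnd hcl c).1 q.1 :=
      h.gaugeRel_canonicalConfiguration_of_isSolution hs hnd hcl c q.2 hr
    exact (ModuliSpace.mk_eq_mk_of_gaugeRel hg).symm

/-- **The moduli space of the family is a single point** for `r = |c|² > 16 sup_N|b|²`. [cite: Taubes1994, Main Theorem] [cite: Taubes1995, Thm. 1.3] -/
theorem subsingleton_moduliSpace (hcl : IsClosedForm s) (c : ℂ)
    (hr : 16 * (⨆ y : N, ∑ k, Complex.normSq ((h.unitaryAdaptedFrames hs hnd).canonicalTorsion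
        ((h.canonicalSpincStructure hs hnd).indexAt y) y
          ((h.canonicalSpincStructure hs hnd).frame ((h.canonicalSpincStructure hs hnd).indexAt y) k y))) < Complex.normSq c) :
    Subsingleton ((h.canonicalSpincStructure hs hnd).ModuliSpace
      (h.taubesPerturbation hs hnd - h.symplecticPerturbation hs hnd (Complex.normSq c / 4))) :=
  ⟨fun p q ↦ by rw [h.moduliSpace_eq_mk_taubesSolution hs hnd hcl c hr p, h.moduliSpace_eq_mk_taubesSolution hs hnd hcl c hr q]⟩

/-- **`𝓜(𝔰_J, P₊F_{A₀} - (r/4)s) ≃ point`** for `r = |c|² > 16 sup_N|b|²`. [cite: Taubes1994, Main Theorem] [cite: Taubes1995, Thm. 1.3] -/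
def moduliSpaceEquivUnit (hcl : IsClosedForm s) (c : ℂ)
    (hr : 16 * (⨆ y : N, ∑ k, Complex.normSq ((h.unitaryAdaptedFrames hs hnd).canonicalTorsion
        ((h.canonicalSpincStructure hs hnd).indexAt y) y
          ((h.canonicalSpincStructure hs hnd).frame ((h.canonicalSpincStructure hs hnd).indexAt y) k y))) < Complex.normSq c) :
    (h.canonicalSpincStructure hs hnd).ModuliSpace
      (h.taubesPerturbation hs hnd - h.symplecticPerturbation hs hnd (Complex.normSq c / 4)) ≃ Unit :=
  haveI := h.subsingleton_moduliSpace hs hnd hcl c hr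
  haveI : Unique ((h.canonicalSpincStructure hs hnd).ModuliSpace
      (h.taubesPerturbation hs hnd - h.symplecticPerturbation hs hnd (Complex.normSq c / 4))) :=
    uniqueOfSubsingleton (Classical.choice (h.nonempty_moduliSpace hs hnd hcl c))
  Equiv.ofUnique _ _

/-- **`#𝓜 = 1`**: the moduli space of the family is finite of cardinality one for `r > 16 sup_N|b|²`
(the count entering `SW(K⁻¹) = ±1`). [cite: Taubes1994, Main Theorem] [cite: Taubes1995, Thm. 1.3, Def. 1.1 (b)] -/
theorem finite_moduliSpace_and_card_eq_one (hcl : IsClosedForm s) (c : ℂ)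
    (hr : 16 * (⨆ y : N, ∑ k, Complex.normSq ((h.unitaryAdaptedFrames hs hnd).canonicalTorsion
        ((h.canonicalSpincStructure hs hnd).indexAt y) y
          ((h.canonicalSpincStructure hs hnd).frame ((h.canonicalSpincStructure hs hnd).indexAt y) k y))) < Complex.normSq c) :
    Finite ((h.canonicalSpincStructure hs hnd).ModuliSpace
        (h.taubesPerturbation hs hnd - h.symplecticPerturbation hs hnd (Complex.normSq c / 4))) ∧
      Nat.card ((h.canonicalSpincStructure hs hnd).ModuliSpace
        (h.taubesPerturbation hs hnd - h.symplecticPerturbation hs hnd (Complex.normSq c / 4))) = 1 := by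
  haveI := h.subsingleton_moduliSpace hs hnd hcl c hr
  haveI := h.nonempty_moduliSpace hs hnd hcl c
  exact ⟨Finite.of_subsingleton, Nat.card_unique⟩

/-- **The point of the moduli space is irreducible** (`c ≠ 0` as `r > 0`; `u₀` vanishes nowhere).
[cite: Taubes1994, §1 (p. 810)] [cite: MorganSWBook1996, Definition 4.5.2] -/
theorem not_isReduciblePoint [Nonempty N] (hcl : IsClosedForm s) (c : ℂ)
    (hr : 16 * (⨆ y : N, ∑ k, Complex.normSq ((h.unitaryAdaptedFrames hs hnd).canonicalTorsion
        ((h.canonicalSpincStructure hs hnd).indexAt y) y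
          ((h.canonicalSpincStructure hs hnd).frame ((h.canonicalSpincStructure hs hnd).indexAt y) k y))) < Complex.normSq c)
    (p : (h.canonicalSpincStructure hs hnd).ModuliSpace
      (h.taubesPerturbation hs hnd - h.symplecticPerturbation hs hnd (Complex.normSq c / 4))) :
    ¬p.IsReduciblePoint := by
  have hT0 : 0 ≤ (⨆ y : N, ∑ k, Complex.normSq ((h.unitaryAdaptedFrames hs hnd).canonicalTorsion
      ((h.canonicalSpincStructure hs hnd).indexAt y) y ((h.canonicalSpincStructure hs hnd).frame ((h.canonicalSpincStructure hs hnd).indexAt y) k y))) :=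
    Real.iSup_nonneg fun y ↦ Finset.sum_nonneg fun k _ ↦ Complex.normSq_nonneg _
  have hr0 : 0 < Complex.normSq c := by nlinarith
  have hc : c ≠ 0 := fun h0 ↦ by rw [h0, map_zero] at hr0; exact lt_irrefl _ hr0
  rw [h.moduliSpace_eq_mk_taubesSolution hs hnd hcl c hr p, ModuliSpace.isReduciblePoint_mk_iff, taubesSolution_val]
  exact h.isIrreducible_canonicalConfiguration hs hnd _ hc

end AlmostComplexStructure.IsCompatibleWith

end Literature.Geometry.Symplectic

end
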